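import Summits.Ventures.HodgeRepro.Night4ReducedDimEightRoute

/-!
# `C2 × C2 × C2` with ANY of its seven involutions: every census face has `dim B_red = 6`

Blind re-derivation cell `pub-hodge-repro`, seat `night-4` (ROUTE HARDENING for the Monday FINAL, gen 4).  Target tree
path `lean/Summits/Ventures/HodgeRepro/Night4ReducedDimEightElementary.lean`.

ROUTE.md v2.89 §3.3: «C2³ (any of its 7 involutions): 6 classes, all 1+1+4 (A × E × E′, E, E′ CM by two DIFFERENT
imaginary quadratic subfields)».  Part II (`Night4ReducedDimEightAbelian`) computes the named involution
`cc_C2xC2xC2 = (1, 0, 0)` on the kernel; the other six are its images under automorphisms of `C2 × C2 × C2` (the group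
`GL₃(𝔽₂)` is transitive on the non-zero vectors).  This file writes down six explicit automorphisms — the coordinate
swaps and the shears `(x, y, z) ↦ (x, x + y, z)` etc. — each sending the given involution to `(1, 0, 0)` (every field
checked by `decide` on the 8 elements / 64 pairs), and transports part II's count along them with
`redDim_faceCorners_transport` (`Night4ReducedDimEightRoute`):

* `redDim_faceCorners_C2xC2xC2_all : ∀ c, IsComplexConj c → ∀ Φ p p′, IsCMType c Φ → p′ ∉ place c p →
  redDim (faceCorners c Φ p p′) = 6` — the route's sentence for ALL seven involutions, KERNEL;
* `simpleDim_C2xC2xC2_all` — for every involution, every CM type is primitive or a lift from an imaginary quadratic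
  subfield (`simpleDim ∈ {1, 4}`).

Nothing here says anything about the status of the Hodge conjecture for CM abelian varieties, which is NOT proved.
-/

set_option autoImplicit false

open Finset

namespace HodgeRepro

/-! ## Six automorphisms of `C2 × C2 × C2` -/

/-- `(x, y, z) ↦ (y, x, z)`: sends `(0, 1, 0)` to `(1, 0, 0)`. -/
def night4Aut_010 : C2xC2xC2 ≃* C2xC2xC2 where
  toFun v := Multiplicative.ofAdd ((Multiplicative.toAdd v).2.1, (Multiplicative.toAdd v).1, (Multiplicative.toAdd v).2.2)
  invFun v := Multiplicative.ofAdd ((Multiplicative.toAdd v).2.1, (Multiplicative.toAdd v).1, (Multiplicative.toAdd v).2.2)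
  left_inv := by intro v; revert v; decide
  right_inv := by intro v; revert v; decide
  map_mul' := by intro a b; revert a b; decide

/-- `(x, y, z) ↦ (z, y, x)`: sends `(0, 0, 1)` to `(1, 0, 0)`. -/
def night4Aut_001 : C2xC2xC2 ≃* C2xC2xC2 where
  toFun v := Multiplicative.ofAdd ((Multiplicative.toAdd v).2.2, (Multiplicative.toAdd v).2.1, (Multiplicative.toAdd v).1)
  invFun v := Multiplicative.ofAdd ((Multiplicative.toAdd v).2.2, (Multiplicative.toAdd v).2.1, (Multiplicative.toAdd v).1)
  left_inv := by intro v; revert v; decide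
  right_inv := by intro v; revert v; decide
  map_mul' := by intro a b; revert a b; decide

/-- `(x, y, z) ↦ (x, x + y, z)`: sends `(1, 1, 0)` to `(1, 0, 0)`. -/
def night4Aut_110 : C2xC2xC2 ≃* C2xC2xC2 where
  toFun v := Multiplicative.ofAdd ((Multiplicative.toAdd v).1,
    (Multiplicative.toAdd v).1 + (Multiplicative.toAdd v).2.1, (Multiplicative.toAdd v).2.2)
  invFun v := Multiplicative.ofAdd ((Multiplicative.toAdd v).1,
    (Multiplicative.toAdd v).1 + (Multiplicative.toAdd v).2.1, (Multiplicative.toAdd v).2.2)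
  left_inv := by intro v; revert v; decide
  right_inv := by intro v; revert v; decide
  map_mul' := by intro a b; revert a b; decide

/-- `(x, y, z) ↦ (x, y, x + z)`: sends `(1, 0, 1)` to `(1, 0, 0)`. -/
def night4Aut_101 : C2xC2xC2 ≃* C2xC2xC2 where
  toFun v := Multiplicative.ofAdd ((Multiplicative.toAdd v).1, (Multiplicative.toAdd v).2.1,
    (Multiplicative.toAdd v).1 + (Multiplicative.toAdd v).2.2)
  invFun v := Multiplicative.ofAdd ((Multiplicative.toAdd v).1, (Multiplicative.toAdd v).2.1,
    (Multiplicative.toAdd v).1 + (Multiplicative.toAdd v).2.2)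
  left_inv := by intro v; revert v; decide
  right_inv := by intro v; revert v; decide
  map_mul' := by intro a b; revert a b; decide

/-- `(x, y, z) ↦ (z, x, y + z)`: sends `(0, 1, 1)` to `(1, 0, 0)` (inverse `(p, q, r) ↦ (q, p + r, p)`). -/
def night4Aut_011 : C2xC2xC2 ≃* C2xC2xC2 where
  toFun v := Multiplicative.ofAdd ((Multiplicative.toAdd v).2.2, (Multiplicative.toAdd v).1,
    (Multiplicative.toAdd v).2.1 + (Multiplicative.toAdd v).2.2)
  invFun v := Multiplicative.ofAdd ((Multiplicative.toAdd v).2.1,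
    (Multiplicative.toAdd v).1 + (Multiplicative.toAdd v).2.2, (Multiplicative.toAdd v).1)
  left_inv := by intro v; revert v; decide
  right_inv := by intro v; revert v; decide
  map_mul' := by intro a b; revert a b; decide

/-- `(x, y, z) ↦ (x, x + y, x + z)`: sends `(1, 1, 1)` to `(1, 0, 0)`. -/
def night4Aut_111 : C2xC2xC2 ≃* C2xC2xC2 where
  toFun v := Multiplicative.ofAdd ((Multiplicative.toAdd v).1,
    (Multiplicative.toAdd v).1 + (Multiplicative.toAdd v).2.1, (Multiplicative.toAdd v).1 + (Multiplicative.toAdd v).2.2)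
  invFun v := Multiplicative.ofAdd ((Multiplicative.toAdd v).1,
    (Multiplicative.toAdd v).1 + (Multiplicative.toAdd v).2.1, (Multiplicative.toAdd v).1 + (Multiplicative.toAdd v).2.2)
  left_inv := by intro v; revert v; decide
  right_inv := by intro v; revert v; decide
  map_mul' := by intro a b; revert a b; decide

/-- Each automorphism sends its involution to the named one `cc_C2xC2xC2 = (1, 0, 0)`. -/
theorem night4Aut_apply :
    night4Aut_010 (Multiplicative.ofAdd (0, 1, 0)) = cc_C2xC2xC2 ∧
    night4Aut_001 (Multiplicative.ofAdd (0, 0, 1)) = cc_C2xC2xC2 ∧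
    night4Aut_110 (Multiplicative.ofAdd (1, 1, 0)) = cc_C2xC2xC2 ∧
    night4Aut_101 (Multiplicative.ofAdd (1, 0, 1)) = cc_C2xC2xC2 ∧
    night4Aut_011 (Multiplicative.ofAdd (0, 1, 1)) = cc_C2xC2xC2 ∧
    night4Aut_111 (Multiplicative.ofAdd (1, 1, 1)) = cc_C2xC2xC2 := by
  decide

/-- The seven involutions of `C2 × C2 × C2`, by enumeration (cf. `complexConjs_C2xC2xC2 : complexConjs C2xC2xC2 =
univ.erase 1`); stated as a list membership (a seven-way disjunction is too large for instance synthesis). -/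
theorem isComplexConj_C2xC2xC2_mem : ∀ c : C2xC2xC2, IsComplexConj c →
    c ∈ [cc_C2xC2xC2, Multiplicative.ofAdd (0, 1, 0), Multiplicative.ofAdd (0, 0, 1), Multiplicative.ofAdd (1, 1, 0),
      Multiplicative.ofAdd (1, 0, 1), Multiplicative.ofAdd (0, 1, 1), Multiplicative.ofAdd (1, 1, 1)] := by
  decide

/-- The seven involutions as a case split. -/
theorem isComplexConj_C2xC2xC2_cases (c : C2xC2xC2) (hc : IsComplexConj c) :
    c = cc_C2xC2xC2 ∨ c = Multiplicative.ofAdd (0, 1, 0) ∨ c = Multiplicative.ofAdd (0, 0, 1) ∨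
    c = Multiplicative.ofAdd (1, 1, 0) ∨ c = Multiplicative.ofAdd (1, 0, 1) ∨
    c = Multiplicative.ofAdd (0, 1, 1) ∨ c = Multiplicative.ofAdd (1, 1, 1) := by
  simpa only [List.mem_cons, List.not_mem_nil, or_false] using isComplexConj_C2xC2xC2_mem c hc

/-! ## The count for every involution -/

/-- **`C2 × C2 × C2` with ANY of its seven involutions: every census face has `dim B_red = 6`** (ROUTE.md §3.3: «C2³ (any
of its 7 involutions): 6 classes, all 1+1+4»).  KERNEL: part II's count for `(1, 0, 0)` transported along the six
automorphisms. -/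
theorem redDim_faceCorners_C2xC2xC2_all {c : C2xC2xC2} (hc : IsComplexConj c) (Φ : Finset C2xC2xC2)
    (p p' : C2xC2xC2) (hΦ : IsCMType c Φ) (hp : p' ∉ place c p) : redDim (faceCorners c Φ p p') = 6 := by
  obtain ⟨h010, h001, h110, h101, h011, h111⟩ := night4Aut_apply
  rcases isComplexConj_C2xC2xC2_cases c hc with rfl | rfl | rfl | rfl | rfl | rfl | rfl
  · exact redDim_faceCorners_C2xC2xC2 Φ p p' hΦ hp
  · refine redDim_faceCorners_transport night4Aut_010 (· = 6) (fun Φ' p₁ p₂ hΦ' hp' => ?_) hΦ hp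
    rw [h010] at hΦ' hp' ⊢
    exact redDim_faceCorners_C2xC2xC2 Φ' p₁ p₂ hΦ' hp'
  · refine redDim_faceCorners_transport night4Aut_001 (· = 6) (fun Φ' p₁ p₂ hΦ' hp' => ?_) hΦ hp
    rw [h001] at hΦ' hp' ⊢
    exact redDim_faceCorners_C2xC2xC2 Φ' p₁ p₂ hΦ' hp'
  · refine redDim_faceCorners_transport night4Aut_110 (· = 6) (fun Φ' p₁ p₂ hΦ' hp' => ?_) hΦ hp
    rw [h110] at hΦ' hp' ⊢
    exact redDim_faceCorners_C2xC2xC2 Φ' p₁ p₂ hΦ' hp'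
  · refine redDim_faceCorners_transport night4Aut_101 (· = 6) (fun Φ' p₁ p₂ hΦ' hp' => ?_) hΦ hp
    rw [h101] at hΦ' hp' ⊢
    exact redDim_faceCorners_C2xC2xC2 Φ' p₁ p₂ hΦ' hp'
  · refine redDim_faceCorners_transport night4Aut_011 (· = 6) (fun Φ' p₁ p₂ hΦ' hp' => ?_) hΦ hp
    rw [h011] at hΦ' hp' ⊢
    exact redDim_faceCorners_C2xC2xC2 Φ' p₁ p₂ hΦ' hp'
  · refine redDim_faceCorners_transport night4Aut_111 (· = 6) (fun Φ' p₁ p₂ hΦ' hp' => ?_) hΦ hp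
    rw [h111] at hΦ' hp' ⊢
    exact redDim_faceCorners_C2xC2xC2 Φ' p₁ p₂ hΦ' hp'

/-- For every involution of `C2 × C2 × C2`, every CM type is primitive (`simpleDim = 4`) or a lift from an imaginary
quadratic subfield (`simpleDim = 1`).  KERNEL (a direct `decide` over the 8 involution candidates × 256 subsets). -/
theorem simpleDim_C2xC2xC2_all : ∀ c : C2xC2xC2, IsComplexConj c → ∀ Φ : Finset C2xC2xC2, IsCMType c Φ →
    simpleDim Φ = 1 ∨ simpleDim Φ = 4 := by
  decide +kernel

end HodgeRepro
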